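import Summits.BirchSwinnertonDyer.BirchSwinnertonDyer.Theorems.PrintCf2SplitBadTwoCMScalarAtVTorsion
import HarnessLib

/-!
# Crux `PrintCf2.SplitBadTwoRankOneOfFacts` (stmt-BirchSwinnertonDyer-20368), road α v10.3/v10.4, S3c input (F3)/(PIN) — CONSUMER FORM:
# for `K`-points `Q`, `Q₁` with `Q₁ = π Q` in `E(K̄)`: `(Q₁)_v − N·Q_v − 2^k R = T_v` with `2T = 0`, `N ≡ 1 − r` — no isogeny, no descent in the statement

Cell `bsd-print-cf2`, EXTRA WIDTH seat `bsd-line-cf2-p1-w3` g10 (prover-bsd-line-cf2-p1-w3-g10-0); `--supports stmt-BirchSwinnertonDyer-20368`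
(helper, Theses-free). HONEST FRAMING: nothing here closes the crux or a registered stub; BSD is not proved by any of this; no summit statement
is proved by this seat. No definition, no named fact, no `sorry`, no kit. beyond-print theorem: no.

WHY. The (PI) 𝒪_K-combination of the (F3) plain road (LEAD cf2-p1 g13 ASSIGN 2026-08-28T23:58:11Z → -w6 g4: «`E(K)_v + 2^N E(K_v) =
ℤ·P_v + E(K_v)[2] + 2^N E(K_v)`») needs «`(πP)_v − N·P_v ∈ E(K_v)[2] + 2^N E(K_v)`» for the `K`-point `πP` (`exists_toGeomPoints_eq_endRing_apply`),
where `(·)_v = Affine.Point.baseChange K K_v`. File 3 (`cmScalar_pointHom_two_torsion_of_frame`, p681283) states this for the DESCENDED map `f` of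
the isogeny realising `π`; THIS FILE removes `φ`, `f`, `ψ` from the statement:
* `baseChange_eq_pointHom_baseChange_of_toGeomPoints_eq` — GENERIC (`V/K`, perfect `K`-field `E`, isogeny `φ`, descended `f` with `ψ ∘ f = φ_E ∘ ψ`):
  if `toGeomPoints Q₁ = φ (toGeomPoints Q)` then `(Q₁)_E = f (Q_E)` (the coordinate embedding `ψ : V(E) ↪ V(Ē)` is injective and carries `Q_E` to
  `ι_* (toGeomPoints Q)`, `Affine.Point.map_baseChange`; `Isogeny.localPointsMap_pointsMap`).
* **`cmEndo_baseChange_sub_smul_eq_two_torsion_of_frame`** — ON EVERY S3c FRAME (pinning clause at `v`, `P ∈ W(ℚ)` of infinite order,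
  `Finite 𝔖_{v̄}(K, E[𝔮_r^∞])`): `∃ k₀, ∀ k ≥ k₀`, for every integer `N ≡ 1 − r (mod 2^k)` and all `K`-points `Q, Q₁` of `E_K` with
  `toGeomPoints Q₁ = π (toGeomPoints Q)`: **`(Q₁)_v − N·Q_v − 2^k·R = T_v` for some `R ∈ E(K_v)` and some `K`-point `T` with `2·T = 0`.**
presearch: as files 1–3 (no Literature fact; the bit «which eigen-summand is the formal group at v» is decided algebraically from (H1′)). playbook: none fit.

References: [Rubin1999] §3 Lemma 3.6 (ii); [Agboola2007] §6 Prop. 6.11; [SilvermanAEC2009] III.§4 Thm. 4.8, Prop. VII.6.3, VIII §1.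
-/

noncomputable section

open scoped Classical

set_option linter.dupNamespace false
set_option autoImplicit false

open NumberField IsDedekindDomain Field WeierstrassCurve
open Literature.NumberTheory.EllipticCurves Literature.NumberTheory.EllipticCurves.GreenbergSelmer
open Literature.NumberTheory.EllipticCurves.Castella2018.AcSelmer
open Literature.NumberTheory.EllipticCurves.Agboola2007
open Literature.NumberTheory.EllipticCurves.ResKernel
open Literature.NumberTheory.GaloisRepresentations

namespace Summit.BirchSwinnertonDyer.BirchSwinnertonDyer.Theorems.PrintCf2.CMPrimes

open Summit.BirchSwinnertonDyer.BirchSwinnertonDyer.Theorems.PrintCf2.RestrictedSelmerPair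
open Summit.BirchSwinnertonDyer.BirchSwinnertonDyer.Theorems.PrintCf2.AdditiveAtSeven
open Summit.BirchSwinnertonDyer.BirchSwinnertonDyer.Theorems.PrintCf2.LocalTrichotomy
open Summit.BirchSwinnertonDyer.BirchSwinnertonDyer.Theorems.PrintCf2.LocalPointsScalar

/-! ## §1. The descended map on base-changed `K`-points -/

section Descent

variable {K : Type} [Field K] (V : WeierstrassCurve K) (E : Type) [Field E] [Algebra K E]

/-- **The descended isogeny on base-changed `K`-points**: for `K`-points `Q, Q₁` with `toGeomPoints Q₁ = φ (toGeomPoints Q)` and any `f : V(E) → V(E)`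
with `ψ ∘ f = φ_E ∘ ψ`, `(Q₁)_E = f (Q_E)` (`(·)_E = Affine.Point.baseChange K E`). [cite: SilvermanAEC2009, III.§4 with VIII.§1] -/
theorem baseChange_eq_pointHom_baseChange_of_toGeomPoints_eq (φ : Isogeny V V)
    (f : (V.baseChange E).toAffine.Point →+ (V.baseChange E).toAffine.Point)
    (hf : ∀ Q, Affine.Point.map (W' := V) (IsScalarTower.toAlgHom K E (AlgebraicClosure E)) (f Q) =
      φ.localPointsMap E (Affine.Point.map (W' := V) (IsScalarTower.toAlgHom K E (AlgebraicClosure E)) Q))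
    (Q Q₁ : V.toAffine.Point) (hQ₁ : toGeomPoints V Q₁ = φ (toGeomPoints V Q)) :
    Affine.Point.baseChange (W' := V) K E Q₁ = f (Affine.Point.baseChange (W' := V) K E Q) := by
  have hψinj : Function.Injective (Affine.Point.map (W' := V) (IsScalarTower.toAlgHom K E (AlgebraicClosure E))) :=
    Affine.Point.map_injective (W' := V) _
  have hj : ∀ T : V.toAffine.Point, (Affine.Point.map (W' := V) (IsScalarTower.toAlgHom K E (AlgebraicClosure E))
      (Affine.Point.baseChange (W' := V) K E T) : localPoints V E) = pointsMap V E (toGeomPoints V T) := by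
    intro T
    change Affine.Point.map _ (Affine.Point.baseChange (W' := V) K E T) =
      Affine.Point.map (closureEmb (K := K) E) (Affine.Point.baseChange (W' := V) K (AlgebraicClosure K) T)
    rw [Affine.Point.map_baseChange, Affine.Point.map_baseChange]
  apply hψinj
  rw [hf, hj, hj, hQ₁, φ.localPointsMap_pointsMap]

end Descent

/-! ## §2. The consumer form on the frame -/

variable {K : Type} [Field K] [NumberField K]

/-- **THE CM SCALAR AT `v`, CONSUMER FORM.** On an S3c frame (pinning clause at `v`, `P ∈ W(ℚ)` of infinite order, `Finite 𝔖_{v̄}(K, E[𝔮_r^∞])`):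
there is `k₀` such that for all `k ≥ k₀`, every integer `N ≡ 1 − r (mod 2^k)` and all `K`-points `Q, Q₁` of `E_K` with
`toGeomPoints Q₁ = π (toGeomPoints Q)` (e.g. `Q₁ = πQ` from `exists_toGeomPoints_eq_endRing_apply`):
`(Q₁)_v − N·Q_v − 2^k·R = T_v` for some `R ∈ E(K_v)` and some `K`-point `T` with `2·T = 0` — i.e. **`(πQ)_v ∈ N·Q_v + 2^k E(K_v) + E(K)[2]_v`**.
(`cmScalar_pointHom_two_torsion_of_frame` for the descended map of the isogeny realising `π`, read on base-changed `K`-points by §1.)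
[cite: Rubin1999, §3 Lemma 3.6 (ii), Cor. 3.17] [cite: Agboola2007, §6 Prop. 6.11 (arXiv p0014)] [cite: SilvermanAEC2009, Prop. VII.6.3] -/
theorem cmEndo_baseChange_sub_smul_eq_two_torsion_of_frame {d : ℤ} (hd0 : d ≠ 0) (hsq : Squarefree d) (hd4 : d % 4 ≠ 1)
    (W : WeierstrassCurve ℚ) [W.IsElliptic] (C : VariableChange ℚ) (hCW : C • W = cm7.quadraticTwist (d : ℚ)) (hK : IsImaginaryQuadratic K)
    (v vbar : HeightOneSpectrum (𝓞 K)) (hv : ((2 : ℕ) : 𝓞 K) ∈ v.asIdeal) (hvbar : ((2 : ℕ) : 𝓞 K) ∈ vbar.asIdeal) (hne : vbar ≠ v)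
    (π : (W.baseChange K).endRing) (hrel : (π : AddMonoid.End (W.baseChange K).geomPoints) * π = π - 2)
    {r : ℤ_[2]} (hr : r * r = r - 2)
    (hpin : ∀ τ ∈ GreenbergSelmer.inertia v, ∀ x : ↥((W.baseChange K).endEigenPrimaryTorsion 2 π r), τ • x = x ∨ τ • x = -x)
    (P : W.toAffine.Point) (hP : ¬ IsOfFinAddOrder P)
    (hfin : Finite (restrictedSelmerBase ↥((W.baseChange K).endEigenPrimaryTorsion 2 π r) 2 vbar)) :
    ∃ k₀ : ℕ, ∀ k : ℕ, k₀ ≤ k → ∀ N : ℤ, ((N : ℤ_[2]) - (1 - r)) ∈ (Ideal.span {(2 : ℤ_[2]) ^ k} : Ideal ℤ_[2]) →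
      ∀ Q Q₁ : (W.baseChange K).toAffine.Point,
        toGeomPoints (W.baseChange K) Q₁ = (π : AddMonoid.End (W.baseChange K).geomPoints) (toGeomPoints (W.baseChange K) Q) →
        ∃ (R : ((W.baseChange K).baseChange (v.adicCompletion K)).toAffine.Point) (T : (W.baseChange K).toAffine.Point),
          2 • T = 0 ∧
          Affine.Point.baseChange (W' := W.baseChange K) K (v.adicCompletion K) Q₁ -
              N • Affine.Point.baseChange (W' := W.baseChange K) K (v.adicCompletion K) Q - ((2 : ℤ) ^ k) • R =
            Affine.Point.baseChange (W' := W.baseChange K) K (v.adicCompletion K) T := by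
  haveI : Fact (Nat.Prime 2) := ⟨Nat.prime_two⟩
  haveI : CharZero (v.adicCompletion K) := charZero_of_injective_algebraMap (algebraMap K (v.adicCompletion K)).injective
  -- the isogeny realising `π` and its descent to `E(K_v)`
  have hπg : (π : AddMonoid.End (W.baseChange K).geomPoints) ∈ (W.baseChange K).geomEndRing := (Subring.mem_inf.1 π.2).1
  have hπG := ((W.baseChange K).mem_equivariantSubring_iff _).1 (Subring.mem_inf.1 π.2).2
  obtain ⟨φ, hφπ, -⟩ := exists_isogeny_apply_eq_cmEndo (W.baseChange K) hπg hπG hrel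
  obtain ⟨f, hf⟩ := exists_pointHom_localPointsMap (W.baseChange K) (v.adicCompletion K) φ
  obtain ⟨k₀, hk₀⟩ := cmScalar_pointHom_two_torsion_of_frame hd0 hsq hd4 W C hCW hK v vbar hv hvbar hne π hrel hr hpin P hP hfin φ hφπ f hf
  refine ⟨k₀, fun k hk N hN Q Q₁ hQ₁ ↦ ?_⟩
  obtain ⟨R, T, h2T, hRT⟩ := hk₀ k hk N hN (Affine.Point.baseChange (W' := W.baseChange K) K (v.adicCompletion K) Q)
  refine ⟨R, T, h2T, ?_⟩
  rw [baseChange_eq_pointHom_baseChange_of_toGeomPoints_eq (W.baseChange K) (v.adicCompletion K) φ f hf Q Q₁ (by rw [hQ₁, hφπ])]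
  exact hRT

end Summit.BirchSwinnertonDyer.BirchSwinnertonDyer.Theorems.PrintCf2.CMPrimes

end
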